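import Literature.NumberTheory.Automorphic.CuspFormCornerDecay
import Literature.NumberTheory.Automorphic.WhittakerTowerDerivative
import Literature.NumberTheory.Automorphic.MirabolicTowerInvariance
import Literature.NumberTheory.Automorphic.JPSSProjectedGlobalIntegral

/-!
# The two chambers for the partial Whittaker transform along the corner
(decay road of line `Sketch`, lead c6; Cogdell (2004), §2.2.1)

Summit `Langlands`, sub-problem `Langlands`, helper file under `Theorems/` supporting the crux `PairLBoundaryJS`
(stmt-Langlands-13622), line `Sketch`, wave 4 (decay road): the analogue of `exists_bound_corner_chambers`
(`CuspFormCornerDecay`) for the function `F = x ↦ Φ_m(ι x)`, `Φ_m = whittakerDepth m Φ` the partial Whittaker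
transform of depth `m` and `ι : GL_m → GL_n` the corner, `0 < m < n`: for `z = z(τ) ∈ A_{GL_m}`, `a = diag(b)` a
`t`-chain and `y` in a compact set,

  `‖F(z a y)‖ ≤ C (τ b_{m-1})^{-B}`  and  `‖F(z a y)‖ ≤ C (τ b₀)^{B}`.

The three bricks enter as hypotheses of `chambers_of_bricks`: the orbit bound for `Φ_m`
(`GapDecayOrbitBound`: `‖Φ_m(g)‖ ≤ sup_{u ∈ 𝒞} ‖Φ(u g)‖` for a compact set `𝒞` of unipotent matrices with standard
columns `≤ m`), the first chamber for the translates `u ι(z a y)` (`GapDecayRegimeA`), and the cusp lemma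
(`GapDecayCuspLemma`: `‖Φ(p)‖ ≤ C |det p|^B` when the `m`-th column of `p` is `e_m`) — the second chamber, because
the `m`-th column of `u ι(x)` is `e_m` and `|det(u ι(z a y))| = τ^{m[K:ℚ]} (∏ bᵢ)^{[K:ℚ]} |det y| ≪ (τ b₀)^{m[K:ℚ]}`
along a chain. Outside the chambers the sup norm of `Φ_m` suffices.

## References

* J. W. Cogdell, *Analytic theory of L-functions for GL_n* (2004), §2.2.1 (PDF p. 183) [CogdellAnalyticTheory2004].
* J. R. Getz, H. Hahn, *An Introduction to Automorphic Representations* (2024), Def. 9.3 [GetzHahn2024].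
-/

noncomputable section

-- `Summit.Langlands.Langlands.…` (summit = sub-problem name, D-0017 layout) trips `dupNamespace`
set_option linter.dupNamespace false

open scoped MatrixGroups Topology Pointwise ENNReal NNReal ComplexConjugate
open scoped Classical Matrix.Norms.Operator
open NumberField IsDedekindDomain MeasureTheory Measure Matrix Set Filter
open Literature.NumberTheory.Automorphic AdelicGroupData

-- the house local instances, exactly as in `RankinSelbergUnfoldingIdentity`
attribute [local instance] adelicBorel borelSpace_adelic locallyCompactSpace_adelic secondCountableTopology_gl_adelic
  glAdeleBorel borelSpace_glAdele borelSpace_ideleGroup secondCountableTopology_ideleGroup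

namespace Summit.Langlands.Langlands.Theorems.GapDecayChambers

section Lemmas

variable {n m : ℕ} {K : Type} [Field K] [NumberField K]

local notation "R" => AdeleRing (𝓞 K) K

/-- `det diag(g, 1) = det g`. [folklore] -/
theorem det_glCorner (h : m ≤ n) (g : GL (Fin m) R) :
    Matrix.GeneralLinearGroup.det (glCorner R h g) = Matrix.GeneralLinearGroup.det g := by
  refine Units.ext ?_
  rw [Matrix.GeneralLinearGroup.val_det_apply, Matrix.GeneralLinearGroup.val_det_apply, coe_glCorner,
    Matrix.reindex_apply, Matrix.det_submatrix_equiv_self, Matrix.det_fromBlocks_zero₂₁, Matrix.det_one, mul_one]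

/-- `|det diag(g, 1)|_𝔸 = |det g|_𝔸`. [folklore] -/
theorem glAbsDet_glCorner (h : m ≤ n) (g : GL (Fin m) R) : glAbsDet n K (glCorner R h g) = glAbsDet m K g := by
  change ideleNormUnits K (Matrix.GeneralLinearGroup.det (glCorner R h g)) =
    ideleNormUnits K (Matrix.GeneralLinearGroup.det g)
  rw [det_glCorner]

/-- `|det diag(z(b))|_𝔸 = (∏ bᵢ)^{[K:ℚ]}`. [folklore] -/
theorem coe_glAbsDet_posRealDiagonal (b : Fin m → ℝ≥0ˣ) :
    (((glAbsDet m K (posRealDiagonal m K b) : ℝ≥0ˣ) : ℝ≥0) : ℝ) =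
      (∏ i, ((b i : ℝ≥0) : ℝ)) ^ Module.finrank ℚ K := by
  have hdet : Matrix.GeneralLinearGroup.det (posRealDiagonal m K b) = posRealIdele K (∏ i, b i) := by
    refine Units.ext ?_
    rw [Matrix.GeneralLinearGroup.val_det_apply, coe_posRealDiagonal, Matrix.det_diagonal, map_prod,
      Units.coe_prod]
  have h1 : ((glAbsDet m K (posRealDiagonal m K b) : ℝ≥0ˣ) : ℝ≥0) =
      IdeleClassGroup.ideleNorm K (Matrix.GeneralLinearGroup.det (posRealDiagonal m K b)) := rfl
  rw [h1, hdet, ideleNorm_posRealIdele_holds K, NNReal.coe_pow, Units.coe_prod, NNReal.coe_prod]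

/-- `|det u|_𝔸 = 1` for upper unitriangular `u`. [folklore] -/
theorem glAbsDet_eq_one_of_mem_upperUnitriangular {u : GL (Fin n) R} (hu : u ∈ upperUnitriangular (Fin n) R) :
    glAbsDet n K u = 1 :=
  glAbsDet_eq_one_of_mem_upperUnitriangular_mul_normOneDiagonal
    ⟨u, hu, 1, one_mem _, mul_one u⟩

/-- The `m`-th column of `u · diag(x, 1)` is `e_m` when `u` is upper unitriangular with standard columns `≤ m`.
[folklore] -/
theorem mul_glCorner_apply_col (hmn : m < n) {u : GL (Fin n) R} (hu : u ∈ upperUnitriangular (Fin n) R)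
    (hcol : ∀ i j : Fin n, (j : ℕ) ≤ m → i ≠ j → (u : Matrix (Fin n) (Fin n) R) i j = 0)
    (x : GL (Fin m) R) (i : Fin n) :
    ((u * glCorner R hmn.le x : GL (Fin n) R) : Matrix (Fin n) (Fin n) R) i ⟨m, hmn⟩ =
      if i = ⟨m, hmn⟩ then 1 else 0 := by
  rw [Units.val_mul, Matrix.mul_apply]
  have hcorner : ∀ l : Fin n, ((glCorner R hmn.le x : GL (Fin n) R) : Matrix (Fin n) (Fin n) R) l ⟨m, hmn⟩ =
      if l = ⟨m, hmn⟩ then 1 else 0 := by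
    intro l
    rw [glCorner_apply_val]
    by_cases hl : (l : ℕ) < m
    · rw [dif_pos hl, dif_neg (lt_irrefl m), if_neg]
      exact fun h => absurd hl (by rw [h]; exact lt_irrefl m)
    · rw [dif_neg hl, if_neg (lt_irrefl m)]
  simp only [hcorner, mul_ite, mul_one, mul_zero, Finset.sum_ite_eq', Finset.mem_univ, if_true]
  by_cases hi : i = ⟨m, hmn⟩
  · subst hi
    rw [if_pos rfl]
    exact ((mem_upperUnitriangular_iff u).1 hu).2 _
  · rw [if_neg hi]
    exact hcol i ⟨m, hmn⟩ le_rfl hi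

/-- Along a `t`-chain (`t bⱼ₊₁ ≤ bⱼ`, `t > 0`) a later entry exceeds an earlier one by at most `t^{-(j-i)}`.
[folklore] -/
theorem le_inv_pow_mul_of_chain {b : Fin m → ℝ} {t : ℝ} (ht : 0 < t)
    (h : ∀ i j : Fin m, (j : ℕ) = (i : ℕ) + 1 → t * b j ≤ b i) {i j : Fin m} (hij : i ≤ j) :
    b j ≤ t⁻¹ ^ ((j : ℕ) - (i : ℕ)) * b i := by
  obtain ⟨j, hj⟩ := j
  obtain ⟨i, hi⟩ := i
  simp only [Fin.le_def] at hij
  simp only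
  induction j, hij using Nat.le_induction with
  | base => simp
  | succ k hik ih =>
    have hk : k < m := Nat.lt_of_succ_lt hj
    have h1 := h ⟨k, hk⟩ ⟨k + 1, hj⟩ rfl
    have h2 := ih hk
    have h3 : b ⟨k + 1, hj⟩ ≤ t⁻¹ * b ⟨k, hk⟩ := by
      rw [le_inv_mul_iff₀ ht]; exact h1
    calc b ⟨k + 1, hj⟩ ≤ t⁻¹ * (t⁻¹ ^ (k - i) * b ⟨i, hi⟩) :=
          h3.trans (mul_le_mul_of_nonneg_left h2 (inv_nonneg.2 ht.le))
      _ = t⁻¹ ^ (k + 1 - i) * b ⟨i, hi⟩ := by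
          rw [← mul_assoc, ← pow_succ', Nat.sub_add_comm hik]

/-- Along a `t`-chain of non-negative reals, `∏ᵢ bᵢ ≤ (T b₀)^m` with `T = max(1, t⁻¹)^m`. [folklore] -/
theorem prod_le_pow_of_chain (hm : 0 < m) {b : Fin m → ℝ} {t : ℝ} (ht : 0 < t) (hb : ∀ i, 0 ≤ b i)
    (h : ∀ i j : Fin m, (j : ℕ) = (i : ℕ) + 1 → t * b j ≤ b i) :
    ∏ i, b i ≤ ((max 1 t⁻¹) ^ m * b ⟨0, hm⟩) ^ m := by
  have hle : ∀ i : Fin m, b i ≤ (max 1 t⁻¹) ^ m * b ⟨0, hm⟩ := by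
    intro i
    have h1 := le_inv_pow_mul_of_chain ht h (show (⟨0, hm⟩ : Fin m) ≤ i from Nat.zero_le _)
    refine h1.trans (mul_le_mul_of_nonneg_right ?_ (hb _))
    calc t⁻¹ ^ ((i : ℕ) - ((⟨0, hm⟩ : Fin m) : ℕ)) ≤ (max 1 t⁻¹) ^ ((i : ℕ) - ((⟨0, hm⟩ : Fin m) : ℕ)) :=
          pow_le_pow_left₀ (inv_nonneg.2 ht.le) (le_max_right _ _) _
      _ ≤ (max 1 t⁻¹) ^ m := pow_le_pow_right₀ (le_max_left _ _) (by simp only; omega)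
  calc ∏ i, b i ≤ ∏ _i : Fin m, (max 1 t⁻¹) ^ m * b ⟨0, hm⟩ :=
        Finset.prod_le_prod (fun i _ => hb i) fun i _ => hle i
    _ = ((max 1 t⁻¹) ^ m * b ⟨0, hm⟩) ^ m := by
        rw [Finset.prod_const, Finset.card_univ, Fintype.card_fin]

end Lemmas

section Main

variable {n m : ℕ} {K : Type} [Field K] [NumberField K]

local notation "R" => AdeleRing (𝓞 K) K

/-- **The two chambers for `F = Φ_m ∘ ι`, granted the three bricks** (orbit bound `h𝒞bd` with the column structure
`h𝒞U`, `h𝒞col` of the compact unipotent set `𝒞`; the cusp lemma `hcusp` for `Φ` at the column `m`; the first chamber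
`hregA` for the translates `u ι(z a y)`, `u ∈ 𝒞`). For `τ > 0`, a `t`-chain `b` and `y` in the compact `Ωm`:
`‖Φ_m(ι(z(τ) diag(b) y))‖ ≤ C (τ b_{m-1})^{-B}` and `≤ C (τ b₀)^{B}`.
[cite: CogdellAnalyticTheory2004, §2.2.1 (PDF p. 183)] -/
theorem chambers_of_bricks (hm : 0 < m) (hmn : m < n)
    {Φ : GL (Fin n) R → ℂ} {M : ℝ} (hM : ∀ g, ‖Φ g‖ ≤ M)
    {𝒞 : Set (GL (Fin n) R)} (h𝒞U : 𝒞 ⊆ (upperUnitriangular (Fin n) R : Set (GL (Fin n) R)))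
    (h𝒞col : ∀ u ∈ 𝒞, ∀ i j : Fin n, (j : ℕ) ≤ m → i ≠ j →
      ((u : GL (Fin n) R) : Matrix (Fin n) (Fin n) R) i j = 0)
    (h𝒞bd : ∀ (g : GL (Fin n) R) (c : ℝ), (∀ u ∈ 𝒞, ‖Φ (u * g)‖ ≤ c) → ‖whittakerDepth m Φ g‖ ≤ c)
    (hcusp : ∀ {B : ℝ}, 0 < B → ∃ C : ℝ, 0 ≤ C ∧ ∀ p : GL (Fin n) R,
      (∀ i : Fin n, (p : Matrix (Fin n) (Fin n) R) i ⟨m, hmn⟩ = if i = ⟨m, hmn⟩ then 1 else 0) →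
      ‖Φ p‖ ≤ C * ((((glAbsDet n K p : ℝ≥0ˣ) : ℝ≥0) : ℝ)) ^ B)
    (hregA : ∀ {Ωm : Set (GL (Fin m) R)}, IsCompact Ωm → ∀ {t : ℝ}, 0 < t → t ≤ 1 → ∀ {B : ℝ}, 0 < B →
      ∃ C : ℝ, 0 ≤ C ∧ ∀ (τ : ℝ≥0ˣ) (b : Fin m → ℝ≥0ˣ),
        (∀ i j : Fin m, (j : ℕ) = (i : ℕ) + 1 → t * ((b j : ℝ≥0) : ℝ) ≤ ((b i : ℝ≥0) : ℝ)) →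
        1 ≤ ((τ : ℝ≥0) : ℝ) * ((b ⟨m - 1, Nat.sub_lt hm one_pos⟩ : ℝ≥0) : ℝ) →
        ∀ y ∈ Ωm, ∀ u ∈ 𝒞,
          ‖Φ (u * glCorner R hmn.le (posRealScalar m K τ * posRealDiagonal m K b * y))‖ ≤
            C * (((τ : ℝ≥0) : ℝ) * ((b ⟨m - 1, Nat.sub_lt hm one_pos⟩ : ℝ≥0) : ℝ)) ^ (-B))
    {Ωm : Set (GL (Fin m) R)} (hΩm : IsCompact Ωm) {t : ℝ} (ht : 0 < t) (ht1 : t ≤ 1) {B : ℝ} (hB : 0 < B) :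
    ∃ C : ℝ, 0 ≤ C ∧ ∀ (τ : ℝ≥0ˣ) (b : Fin m → ℝ≥0ˣ),
      (∀ i j : Fin m, (j : ℕ) = (i : ℕ) + 1 → t * ((b j : ℝ≥0) : ℝ) ≤ ((b i : ℝ≥0) : ℝ)) →
      ∀ y ∈ Ωm,
        ‖whittakerDepth m Φ (glCorner R hmn.le (posRealScalar m K τ * posRealDiagonal m K b * y))‖ ≤
            C * (((τ : ℝ≥0) : ℝ) * ((b ⟨m - 1, Nat.sub_lt hm one_pos⟩ : ℝ≥0) : ℝ)) ^ (-B) ∧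
        ‖whittakerDepth m Φ (glCorner R hmn.le (posRealScalar m K τ * posRealDiagonal m K b * y))‖ ≤
            C * (((τ : ℝ≥0) : ℝ) * ((b ⟨0, hm⟩ : ℝ≥0) : ℝ)) ^ B := by
  -- the sup norm
  have hM0 : ∀ g, ‖Φ g‖ ≤ max M 0 := fun g => (hM g).trans (le_max_left _ _)
  have hMM : 0 ≤ max M 0 := le_max_right _ _
  -- `|det y|` is bounded on `Ωm`
  obtain ⟨Dy, hDy⟩ := (hΩm.image (continuous_glAbsDet_real m K)).bddAbove
  set Dy' : ℝ := max Dy 1 with hDy'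
  have hDy'0 : 0 < Dy' := lt_of_lt_of_le one_pos (le_max_right _ _)
  have hDyle : ∀ y ∈ Ωm, (((glAbsDet m K y : ℝ≥0ˣ) : ℝ≥0) : ℝ) ≤ Dy' := fun y hy =>
    (hDy ⟨y, hy, rfl⟩).trans (le_max_left _ _)
  -- the constants of the bricks
  obtain ⟨CA, hCA0, hCA⟩ := hregA hΩm ht ht1 hB
  set D : ℕ := Module.finrank ℚ K with hD
  have hD0 : 0 < D := Module.finrank_pos
  set B' : ℝ := B / ((m : ℝ) * D) with hB'
  have hmD0 : (0 : ℝ) < (m : ℝ) * D := by positivity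
  have hB'0 : 0 < B' := div_pos hB hmD0
  obtain ⟨Cc, hCc0, hCc⟩ := hcusp hB'0
  set T : ℝ := (max 1 t⁻¹) ^ m with hT
  have hT0 : 0 < T := by positivity
  set C₂ : ℝ := Cc * ((T ^ m) ^ D * Dy') ^ B' with hC₂
  have hC₂0 : 0 ≤ C₂ := by positivity
  set C : ℝ := max (max CA (max M 0)) C₂ with hC
  have hC0 : 0 ≤ C := hMM.trans ((le_max_right _ _).trans (le_max_left _ _))
  refine ⟨C, hC0, fun τ b hchain y hy => ?_⟩
  set τr : ℝ := ((τ : ℝ≥0) : ℝ) with hτr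
  have hτr0 : 0 < τr := NNReal.coe_pos.2 (pos_iff_ne_zero.2 τ.ne_zero)
  set β : Fin m → ℝ := fun i => ((b i : ℝ≥0) : ℝ) with hβ
  have hβ0 : ∀ i, 0 < β i := fun i => NNReal.coe_pos.2 (pos_iff_ne_zero.2 (b i).ne_zero)
  set x : GL (Fin m) R := posRealScalar m K τ * posRealDiagonal m K b * y with hx
  have hsup : ‖whittakerDepth m Φ (glCorner R hmn.le x)‖ ≤ max M 0 := norm_whittakerDepth_le hM0 m _
  refine ⟨?_, ?_⟩
  · -- first chamber
    by_cases h1 : 1 ≤ τr * β ⟨m - 1, Nat.sub_lt hm one_pos⟩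
    · have := h𝒞bd (glCorner R hmn.le x) _ fun u hu => hCA τ b hchain h1 y hy u hu
      exact this.trans (mul_le_mul_of_nonneg_right ((le_max_left _ _).trans (le_max_left _ _))
        (Real.rpow_nonneg (mul_pos hτr0 (hβ0 _)).le _))
    · push Not at h1
      have hle1 : 1 ≤ (τr * β ⟨m - 1, Nat.sub_lt hm one_pos⟩) ^ (-B) :=
        Real.one_le_rpow_of_pos_of_le_one_of_nonpos (mul_pos hτr0 (hβ0 _)) h1.le (neg_nonpos.2 hB.le)
      calc ‖whittakerDepth m Φ (glCorner R hmn.le x)‖ ≤ max M 0 * 1 := by rw [mul_one]; exact hsup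
        _ ≤ C * (τr * β ⟨m - 1, Nat.sub_lt hm one_pos⟩) ^ (-B) :=
            mul_le_mul (((le_max_right _ _).trans (le_max_left _ _))) hle1 zero_le_one hC0
  · -- second chamber
    by_cases h2 : τr * β ⟨0, hm⟩ ≤ 1
    · have key : ∀ u ∈ 𝒞, ‖Φ (u * glCorner R hmn.le x)‖ ≤ C₂ * (τr * β ⟨0, hm⟩) ^ B := by
        intro u hu
        have h3 := hCc (u * glCorner R hmn.le x) (mul_glCorner_apply_col hmn (h𝒞U hu) (h𝒞col u hu) x)
        -- the determinant of `u ι(x)`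
        have hΔ : (((glAbsDet n K (u * glCorner R hmn.le x) : ℝ≥0ˣ) : ℝ≥0) : ℝ) =
            τr ^ (m * D) * (∏ i, β i) ^ D * (((glAbsDet m K y : ℝ≥0ˣ) : ℝ≥0) : ℝ) := by
          rw [map_mul, glAbsDet_eq_one_of_mem_upperUnitriangular (h𝒞U hu), one_mul, glAbsDet_glCorner, hx,
            map_mul, map_mul, glAbsDet_posRealScalar, Units.val_mul, Units.val_mul, NNReal.coe_mul, NNReal.coe_mul,
            coe_glAbsDet_posRealDiagonal, Units.val_pow_eq_pow_val, NNReal.coe_pow]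
        have hprod : (∏ i, β i) ≤ (T * β ⟨0, hm⟩) ^ m :=
          prod_le_pow_of_chain hm ht (fun i => (hβ0 i).le) hchain
        have hΔle : (((glAbsDet n K (u * glCorner R hmn.le x) : ℝ≥0ˣ) : ℝ≥0) : ℝ) ≤
            ((T ^ m) ^ D * Dy') * (τr * β ⟨0, hm⟩) ^ (m * D) := by
          rw [hΔ]
          have hprod0 : 0 ≤ ∏ i, β i := Finset.prod_nonneg fun i _ => (hβ0 i).le
          calc τr ^ (m * D) * (∏ i, β i) ^ D * (((glAbsDet m K y : ℝ≥0ˣ) : ℝ≥0) : ℝ)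
              ≤ τr ^ (m * D) * ((T * β ⟨0, hm⟩) ^ m) ^ D * Dy' := by
                refine mul_le_mul (mul_le_mul_of_nonneg_left (pow_le_pow_left₀ hprod0 hprod D) (by positivity))
                  (hDyle y hy) (NNReal.coe_nonneg _) (by positivity)
            _ = ((T ^ m) ^ D * Dy') * (τr * β ⟨0, hm⟩) ^ (m * D) := by ring
        have hpos : 0 < (((glAbsDet n K (u * glCorner R hmn.le x) : ℝ≥0ˣ) : ℝ≥0) : ℝ) := by
          rw [hΔ]
          have : 0 < (((glAbsDet m K y : ℝ≥0ˣ) : ℝ≥0) : ℝ) :=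
            NNReal.coe_pos.2 (pos_iff_ne_zero.2 (glAbsDet m K y).ne_zero)
          have hprod0 : 0 < ∏ i, β i := Finset.prod_pos fun i _ => hβ0 i
          exact mul_pos (mul_pos (pow_pos hτr0 _) (pow_pos hprod0 _)) this
        have hrpow : ((((glAbsDet n K (u * glCorner R hmn.le x) : ℝ≥0ˣ) : ℝ≥0) : ℝ)) ^ B' ≤
            ((T ^ m) ^ D * Dy') ^ B' * (τr * β ⟨0, hm⟩) ^ B := by
          have h4 := Real.rpow_le_rpow hpos.le hΔle hB'0.le
          rw [Real.mul_rpow (by positivity) (by positivity)] at h4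
          refine h4.trans (le_of_eq ?_)
          congr 1
          rw [← Real.rpow_natCast, ← Real.rpow_mul (by positivity), hB']
          congr 1
          push_cast
          field_simp
        calc ‖Φ (u * glCorner R hmn.le x)‖
            ≤ Cc * ((((glAbsDet n K (u * glCorner R hmn.le x) : ℝ≥0ˣ) : ℝ≥0) : ℝ)) ^ B' := h3
          _ ≤ Cc * (((T ^ m) ^ D * Dy') ^ B' * (τr * β ⟨0, hm⟩) ^ B) := mul_le_mul_of_nonneg_left hrpow hCc0
          _ = C₂ * (τr * β ⟨0, hm⟩) ^ B := by rw [hC₂]; ring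
      have := h𝒞bd (glCorner R hmn.le x) _ key
      exact this.trans (mul_le_mul_of_nonneg_right (le_max_right _ _) (Real.rpow_nonneg (mul_pos hτr0 (hβ0 _)).le _))
    · push Not at h2
      have hle1 : 1 ≤ (τr * β ⟨0, hm⟩) ^ B := Real.one_le_rpow h2.le hB.le
      calc ‖whittakerDepth m Φ (glCorner R hmn.le x)‖ ≤ max M 0 * 1 := by rw [mul_one]; exact hsup
        _ ≤ C * (τr * β ⟨0, hm⟩) ^ B :=
            mul_le_mul (((le_max_right _ _).trans (le_max_left _ _))) hle1 zero_le_one hC0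

end Main

section Registered

/-- **Registered sub-stub `stub_decay_chambers_of_bricks`** (line `Sketch`, wave 4, lead c6): closed form of
`chambers_of_bricks`. [cite: CogdellAnalyticTheory2004, §2.2.1 (PDF p. 183)] -/
theorem stub_decay_chambers_of_bricks :
    ∀ {n m : ℕ} {K : Type} [Field K] [NumberField K] (hm : 0 < m) (hmn : m < n)
    {Φ : GL (Fin n) (AdeleRing (𝓞 K) K) → ℂ} {M : ℝ} (hM : ∀ g, ‖Φ g‖ ≤ M)
    {𝒞 : Set (GL (Fin n) (AdeleRing (𝓞 K) K))} (h𝒞U : 𝒞 ⊆ (upperUnitriangular (Fin n) (AdeleRing (𝓞 K) K) : Set (GL (Fin n) (AdeleRing (𝓞 K) K))))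
    (h𝒞col : ∀ u ∈ 𝒞, ∀ i j : Fin n, (j : ℕ) ≤ m → i ≠ j →
      ((u : GL (Fin n) (AdeleRing (𝓞 K) K)) : Matrix (Fin n) (Fin n) (AdeleRing (𝓞 K) K)) i j = 0)
    (h𝒞bd : ∀ (g : GL (Fin n) (AdeleRing (𝓞 K) K)) (c : ℝ), (∀ u ∈ 𝒞, ‖Φ (u * g)‖ ≤ c) → ‖whittakerDepth m Φ g‖ ≤ c)
    (hcusp : ∀ {B : ℝ}, 0 < B → ∃ C : ℝ, 0 ≤ C ∧ ∀ p : GL (Fin n) (AdeleRing (𝓞 K) K),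
      (∀ i : Fin n, (p : Matrix (Fin n) (Fin n) (AdeleRing (𝓞 K) K)) i ⟨m, hmn⟩ = if i = ⟨m, hmn⟩ then 1 else 0) →
      ‖Φ p‖ ≤ C * ((((glAbsDet n K p : ℝ≥0ˣ) : ℝ≥0) : ℝ)) ^ B)
    (hregA : ∀ {Ωm : Set (GL (Fin m) (AdeleRing (𝓞 K) K))}, IsCompact Ωm → ∀ {t : ℝ}, 0 < t → t ≤ 1 → ∀ {B : ℝ}, 0 < B →
      ∃ C : ℝ, 0 ≤ C ∧ ∀ (τ : ℝ≥0ˣ) (b : Fin m → ℝ≥0ˣ),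
        (∀ i j : Fin m, (j : ℕ) = (i : ℕ) + 1 → t * ((b j : ℝ≥0) : ℝ) ≤ ((b i : ℝ≥0) : ℝ)) →
        1 ≤ ((τ : ℝ≥0) : ℝ) * ((b ⟨m - 1, Nat.sub_lt hm one_pos⟩ : ℝ≥0) : ℝ) →
        ∀ y ∈ Ωm, ∀ u ∈ 𝒞,
          ‖Φ (u * glCorner (AdeleRing (𝓞 K) K) hmn.le (posRealScalar m K τ * posRealDiagonal m K b * y))‖ ≤
            C * (((τ : ℝ≥0) : ℝ) * ((b ⟨m - 1, Nat.sub_lt hm one_pos⟩ : ℝ≥0) : ℝ)) ^ (-B))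
    {Ωm : Set (GL (Fin m) (AdeleRing (𝓞 K) K))} (hΩm : IsCompact Ωm) {t : ℝ} (ht : 0 < t) (ht1 : t ≤ 1) {B : ℝ} (hB : 0 < B),
    ∃ C : ℝ, 0 ≤ C ∧ ∀ (τ : ℝ≥0ˣ) (b : Fin m → ℝ≥0ˣ),
      (∀ i j : Fin m, (j : ℕ) = (i : ℕ) + 1 → t * ((b j : ℝ≥0) : ℝ) ≤ ((b i : ℝ≥0) : ℝ)) →
      ∀ y ∈ Ωm,
        ‖whittakerDepth m Φ (glCorner (AdeleRing (𝓞 K) K) hmn.le (posRealScalar m K τ * posRealDiagonal m K b * y))‖ ≤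
            C * (((τ : ℝ≥0) : ℝ) * ((b ⟨m - 1, Nat.sub_lt hm one_pos⟩ : ℝ≥0) : ℝ)) ^ (-B) ∧
        ‖whittakerDepth m Φ (glCorner (AdeleRing (𝓞 K) K) hmn.le (posRealScalar m K τ * posRealDiagonal m K b * y))‖ ≤
            C * (((τ : ℝ≥0) : ℝ) * ((b ⟨0, hm⟩ : ℝ≥0) : ℝ)) ^ B := by
  intro n m K _ _ hm hmn Φ M hM 𝒞 h𝒞U h𝒞col h𝒞bd hcusp hregA Ωm hΩm t ht ht1 B hB
  exact chambers_of_bricks hm hmn hM h𝒞U h𝒞col h𝒞bd hcusp hregA hΩm ht ht1 hB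

end Registered

end Summit.Langlands.Langlands.Theorems.GapDecayChambers

end
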